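import Summits.ResolutionOfSingularities.ResolutionOfSingularities.Theorems.FrobeniusClosingSteerToricUnitExitPhiStep
import Summits.ResolutionOfSingularities.ResolutionOfSingularities.Theorems.FrobeniusClosingSteerToricUnitExitEnd
import Summits.ResolutionOfSingularities.ResolutionOfSingularities.Theorems.FrobeniusClosingSteerToricUnitExitTower

/-!
# Crux `Steer` (stmt-ResolutionOfSingularities-16345) — K-TX part 4 CLOSED: the toric tower with case B settled, and res-L0-w41-strat-1's
# `concl_of_unit_dominant_monomial` WITHOUT the extra value hypothesis

OURS; [cite: NovacoskiSpivakovsky2014, Def. 2.8, Lemma 2.5, Lemma 2.9]; [cite: CossartPiltant2008, §4]; [cite: Matsumura1987, Thm. 14.2].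

* `exists_toric_tower_caseB` — `…Tower.exists_toric_tower` run with the TRANSPORTED frame (`…Phi`, `…PhiStep`): same tower, same
  radicand `z·W`, and in the case the odd survivor `z` is a UNIT the extra conclusion `∀ h, z·W − h² ∉ 𝔪²` (the end theorem
  `…End.unit_sub_sq_not_mem_sq_of_dual` applied to the transported data: `Φ W = w̄` because every `r_i` carries a non-unit letter).
* `concl_of_unit_dominant_monomial` — K-TX as typed by res-L0-w41-strat-1 (stub `stub_unit_linear_tower` retyped, RULING 258(c)/259(b)),
  now unconditional: case A by `isRegularLocalRing_adjoinRoot_linear_unit`, case B by the bullet above and the tree criterion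
  `RadicandSingular.not_isRegularLocalRing_adjoinRoot_atMaximalIdeal_iff`; then `SteeredExit.concl_of_exit`.
-/

noncomputable section

-- single-problem summit: the doubled namespace component `ResolutionOfSingularities` is forced
set_option linter.dupNamespace false

open scoped BigOperators

namespace Summit.ResolutionOfSingularities.ResolutionOfSingularities.Theorems.SteerToricUnitExit

open Polynomial IsLocalRing
open Literature.AlgebraicGeometry.Resolution
open Summit.ResolutionOfSingularities.ResolutionOfSingularities.Theorems.SwitchingDichotomy
open Summit.ResolutionOfSingularities.ResolutionOfSingularities.Theorems.SteerToricVertexExit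

variable {k K : Type} [Field k] [Field K] [Algebra k K]

section Tower

/-- **The toric tower with case B settled.** See the module docstring and `…Tower.exists_toric_tower`. OURS.
[cite: NovacoskiSpivakovsky2014, Def. 2.11] [cite: CossartPiltant2008, §4] -/
theorem exists_toric_tower_caseB [CharP K 2] (O : ValuationSubring K)
    (R : ℕ → Subring K) (s : ℕ → K) (N : ℕ)
    (hstep : ∀ i < N, IsLocalBlowup O (R i) (R (i + 1)) ∧
      ∃ x g : K, x ∈ R i ∧ g ∈ R i ∧ s i = x * s (i + 1) + g)
    (hreg : IsRegularLocalRing (R N)) (hRO : R N ≤ O.toSubring)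
    (hcen : ∀ a : R N, a ∈ maximalIdeal (R N) ↔ O.valuation (a : K) < 1)
    {n m : ℕ} (y : Fin n → R N) (hy : Ideal.span (Set.range y) = maximalIdeal (R N))
    (hn : ringKrullDim (R N) = n)
    (g w : R N) (hw : IsUnit w) (a : Fin m → R N)
    (M : Fin n → ℕ) (hodd : ∃ j, Odd (M j)) (E : Fin m → Fin n → ℕ)
    (heq : s N ^ 2 = (g : K) ^ 2 + (w : K) * ∏ j, (y j : K) ^ M j +
      ∑ i, (a i : K) * ∏ j, (y j : K) ^ E i j)
    (hdom : ∀ i, O.valuation (∏ j, (y j : K) ^ E i j) < O.valuation (∏ j, (y j : K) ^ M j)) :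
    ∃ (R' : ℕ → Subring K) (s' : ℕ → K) (N' : ℕ), R' 0 = R 0 ∧ s' 0 = s 0 ∧
      (∀ i < N', IsLocalBlowup O (R' i) (R' (i + 1)) ∧
        ∃ x g : K, x ∈ R' i ∧ g ∈ R' i ∧ s' i = x * s' (i + 1) + g) ∧
      ∃ (_ : IsRegularLocalRing (R' N')), R' N' ≤ O.toSubring ∧
        (∀ q : R' N', q ∈ maximalIdeal (R' N') ↔ O.valuation (q : K) < 1) ∧
        ∃ (hsq : s' N' ^ 2 ∈ R' N') (z W : R' N') (r : K),
          (⟨s' N' ^ 2, hsq⟩ : R' N') = z * W ∧ IsUnit W ∧ (∏ j, (y j : K) ^ M j) = (z : K) * r ^ 2 ∧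
          ((z ∈ maximalIdeal (R' N') ∧ z ∉ maximalIdeal (R' N') ^ 2) ∨
            (IsUnit z ∧ ∀ h : R' N', z * W - h ^ 2 ∉ maximalIdeal (R' N') ^ 2)) := by
  classical
  have htwo : (2 : K) = 0 := by exact_mod_cast CharP.cast_eq_zero K 2
  -- §1.1 the starting frame and the ratios
  set z₀ : Fin n → K := fun j => (y j : K) with hz₀
  have hF₀ : Frame O (R N) z₀ := frame_of_rsop O (R N) hreg hRO hcen y hy hn
  have hy0 : ∀ j, z₀ j ≠ 0 := hF₀.ne_zero
  set F : Fin m → Fin n → ℤ := fun i j => (E i j : ℤ) - M j with hFdef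
  have hP0 : (∏ j, z₀ j ^ M j) ≠ 0 := Finset.prod_ne_zero_iff.mpr fun j _ => pow_ne_zero _ (hy0 j)
  have hratio : ∀ i, (∏ j, z₀ j ^ F i j) = (∏ j, z₀ j ^ E i j) / ∏ j, z₀ j ^ M j := fun i => by
    rw [eq_div_iff hP0, ← SteerToricVertexExit.prod_zpow_natCast, ← SteerToricVertexExit.prod_zpow_natCast, ← SteerToricConcl.prod_zpow_add z₀ hy0]
    exact Finset.prod_congr rfl fun j _ => by simp [hFdef]
  have hF1 : ∀ i, O.valuation (∏ j, z₀ j ^ F i j) < 1 := fun i => by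
    rw [hratio, map_div₀]
    exact (div_lt_one₀ (zero_lt_iff.mpr ((_root_.map_ne_zero _).mpr hP0))).mpr (hdom i)
  -- §1.2 the transported starting state: `Φ₀ = constants`, no unit letters
  haveI := kerRes_isPrime O
  let Φ₀ : R N →+* Localization.AtPrime (kerRes O) :=
    ((algebraMap (MvPolynomial (K × ℕ) (ResidueField O)) (Localization.AtPrime (kerRes O))).comp
      (MvPolynomial.C : ResidueField O →+* MvPolynomial (K × ℕ) (ResidueField O))).comp
      ((residue O).comp (Subring.inclusion hRO))
  have hΦ₀ : ∀ r : R N, Φ₀ r = algebraMap (MvPolynomial (K × ℕ) (ResidueField O)) (Localization.AtPrime (kerRes O))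
      (MvPolynomial.C (resK O (r : K))) := fun r => by
    show algebraMap (MvPolynomial (K × ℕ) (ResidueField O)) (Localization.AtPrime (kerRes O))
      (MvPolynomial.C (residue O (Subring.inclusion hRO r))) = _
    rw [resK_of_mem O (hRO r.2)]; rfl
  have hyv : ∀ j, O.valuation (z₀ j) < 1 := fun j => (hcen (y j)).mp (hy ▸ Ideal.subset_span ⟨j, rfl⟩)
  let s₀ : TState O n := ⟨R N, z₀, Φ₀, fun _ => 0, fun _ => 0, fun _ => 0, fun _ _ => 0, 0⟩
  have hs₀ : Good (R N) s₀ := by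
    refine ⟨hF₀, hRO, le_rfl, fun r => ?_, fun r _ => hΦ₀ r, fun j r hr hvj => ?_, fun j r hr hvj => ?_, fun j v hv => ?_,
      fun _ _ _ => rfl, fun j hj => ?_⟩
    · rw [hΦ₀, evalResL_algebraMap, resK_of_mem O (hRO r.2)]
      show MvPolynomial.aeval _ (MvPolynomial.C _) = _
      rw [MvPolynomial.aeval_C]; rfl
    · change (r : K) = z₀ j at hr
      rw [hΦ₀, hr, (resK_eq_zero_iff O (hRO (hr ▸ r.2 : z₀ j ∈ R N) |> fun h => hRO (y j).2)).mpr (hyv j),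
        MvPolynomial.C_0, map_zero]
    · exact absurd (hyv j) (by change O.valuation (z₀ j) = 1 at hvj; rw [hvj]; exact lt_irrefl _)
    · simp [s₀] at hv
    · exact absurd (hyv j) (by change O.valuation (z₀ j) = 1 at hj; rw [hj]; exact lt_irrefl _)
  -- Perron and odd-support reduction, transported
  obtain ⟨s₁, T₁, hR₁, hT₁F⟩ := exists_prel_nonneg_family (R N) m s₀ hs₀ F hF1
  set p₀ : Fin n → ℤ := fun j => (M j : ℤ) with hp₀
  have hp₀nn : ∀ j, 0 ≤ p₀ j := fun j => by simp [hp₀]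
  have hp₀odd : ∃ j, Odd (p₀ j) := by
    obtain ⟨j, hj⟩ := hodd; exact ⟨j, by simpa [hp₀] using (Int.odd_coe_nat _).mpr hj⟩
  obtain ⟨s₂, T₂, hR₂, ia, ha, heven⟩ := exists_prel_single_odd (R N) s₁ (prel_good hR₁) (T₁ p₀) (prel_odd hR₁ _ hp₀odd)
  have hR : PRel (R N) s₀ s₂ (T₂ ∘ T₁) := prel_trans hR₁ hR₂
  set z₂ : Fin n → K := s₂.z with hz₂def
  set R₂ : Subring K := s₂.R with hR₂def
  obtain ⟨⟨hbl, hF₂, hmono, -, hnn, -⟩, hNR₂, hgood₂, -⟩ := hR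
  obtain ⟨hR₂O', -, hΦ₂, hconst₂, hkill₂, hunit₂, hsupp₂, -, hdual₂⟩ := hgood₂
  obtain ⟨hreg₂, hR₂O, hR₂loc, hcen₂, hz₂0, hz₂, -⟩ := id hF₂
  set p : Fin n → ℤ := T₂ (T₁ p₀) with hp
  set gv : Fin m → Fin n → ℤ := fun i => T₂ (T₁ (F i)) with hgv
  have hpnn : ∀ j, 0 ≤ p j := hnn _ hp₀nn
  have hgnn : ∀ i j, 0 ≤ gv i j := fun i => prel_nonneg hR₂ _ (hT₁F i)
  have hp_eq : (∏ j, z₂ j ^ p j) = ∏ j, z₀ j ^ M j := by rw [hp, ← SteerToricVertexExit.prod_zpow_natCast]; exact hmono p₀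
  have hg_eq : ∀ i, (∏ j, z₂ j ^ gv i j) = ∏ j, z₀ j ^ F i j := fun i => hmono (F i)
  -- §1.3 `y^M = z_a · ỹ²`
  set q : Fin n → ℤ := fun j => p j / 2 with hq
  have hqnn : ∀ j, 0 ≤ q j := fun j => Int.ediv_nonneg (hpnn j) (by norm_num)
  have hpq : ∀ j, p j = 2 * q j + if j = ia then 1 else 0 := fun j => by
    have hqj : q j = p j / 2 := rfl
    by_cases hja : j = ia
    · subst hja; rw [if_pos rfl, hqj]; have h := Int.odd_iff.mp ha; omega
    · rw [if_neg hja, add_zero, hqj]; have h := Int.even_iff.mp (heven j hja); omega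
  set yt : K := ∏ j, z₂ j ^ q j with hyt
  have hyt0 : yt ≠ 0 := Finset.prod_ne_zero_iff.mpr fun j _ => zpow_ne_zero _ (hz₂0 j)
  have hytR : yt ∈ R₂ := by
    rw [hyt, prod_zpow_eq_prod_pow_toNat z₂ q hqnn]; exact prod_mem fun j _ => pow_mem (hz₂ j) _
  have hP : (∏ j, z₀ j ^ M j) = z₂ ia * yt ^ 2 := by
    rw [← hp_eq, Finset.prod_congr rfl fun j _ => by rw [hpq j], SteerToricConcl.prod_zpow_add z₂ hz₂0,
      SteerToricConcl.prod_zpow_mul z₂ 2 q, prod_zpow_indicator, hyt, mul_comm]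
    norm_cast
  -- §1.4 the unit cofactor `W = w + Σ a_i r_i`
  set rv : Fin m → K := fun i => ∏ j, z₂ j ^ gv i j with hrv
  have hrvR : ∀ i, rv i ∈ R₂ := fun i => by
    show (∏ j, z₂ j ^ gv i j) ∈ R₂
    rw [prod_zpow_eq_prod_pow_toNat z₂ (gv i) (hgnn i)]; exact prod_mem fun j _ => pow_mem (hz₂ j) _
  have hrv1 : ∀ i, O.valuation (rv i) < 1 := fun i => by show O.valuation (∏ j, z₂ j ^ gv i j) < 1; rw [hg_eq]; exact hF1 i
  set Wv : K := (w : K) + ∑ i, (a i : K) * rv i with hWv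
  have hWvR : Wv ∈ R₂ := add_mem (hNR₂ w.2) (sum_mem fun i _ => mul_mem (hNR₂ (a i).2) (hrvR i))
  have hvw : O.valuation (w : K) = 1 := by
    apply le_antisymm ((O.valuation_le_one_iff _).mpr (hRO w.2))
    by_contra hlt
    push Not at hlt
    exact (IsLocalRing.mem_maximalIdeal _).mp ((hcen w).mpr hlt) hw
  have hvW : O.valuation Wv = 1 := by
    rw [hWv, Valuation.map_add_eq_of_lt_left]
    · exact hvw
    · rw [hvw]
      refine Valuation.map_sum_lt _ one_ne_zero fun i _ => ?_
      rw [Valuation.map_mul]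
      calc O.valuation (a i : K) * O.valuation (rv i) ≤ 1 * O.valuation (rv i) :=
            mul_le_mul_left ((O.valuation_le_one_iff _).mpr (hRO (a i).2)) _
        _ < 1 := by rw [one_mul]; exact hrv1 i
  have hWunit : IsUnit (⟨Wv, hWvR⟩ : R₂) := by
    by_contra hnu
    have := (hcen₂ _).mp ((IsLocalRing.mem_maximalIdeal _).mpr hnu)
    exact absurd hvW (ne_of_lt this)
  -- §1.5 the division step `t₁ = (s N − g)/ỹ`, `t₁² = z_a · W`
  set t₁ : K := (s N - g) / yt with ht₁
  have hsum : (∑ i, (a i : K) * ∏ j, z₀ j ^ E i j) = (∏ j, z₀ j ^ M j) * ∑ i, (a i : K) * rv i := by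
    rw [Finset.mul_sum]
    refine Finset.sum_congr rfl fun i _ => ?_
    have e : (∏ j, z₀ j ^ E i j) = (∏ j, z₀ j ^ M j) * rv i := by
      show (∏ j, z₀ j ^ E i j) = (∏ j, z₀ j ^ M j) * ∏ j, z₂ j ^ gv i j
      rw [hg_eq, hratio, mul_div_cancel₀ _ hP0]
    rw [e]; ring
  have hsq_id : (s N - g) ^ 2 = z₂ ia * yt ^ 2 * Wv := by
    have e : (s N - (g : K)) ^ 2 = s N ^ 2 + (g : K) ^ 2 - 2 * (s N * g) := by ring
    rw [e, htwo, zero_mul, sub_zero, heq, hsum, hP, hWv]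
    have e2 : ((g : K)) ^ 2 + ((g : K)) ^ 2 = 2 * (g : K) ^ 2 := by ring
    linear_combination e2 + (0 : K) * htwo + (g : K) ^ 2 * htwo
  have ht₁sq : t₁ ^ 2 = z₂ ia * Wv := by
    rw [ht₁, div_pow, hsq_id]; field_simp
  have ht₁R : t₁ ^ 2 ∈ R₂ := by rw [ht₁sq]; exact mul_mem (hz₂ ia) hWvR
  -- §1.6 the extended tower
  let R' : ℕ → Subring K := fun i => if i ≤ N then R i else R₂
  let s' : ℕ → K := fun i => if i ≤ N then s i else if i = N + 1 then s N else t₁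
  have hR'N2 : R' (N + 2) = R₂ := by simp [R']
  have hs'N2 : s' (N + 2) = t₁ := by simp [s']
  have hblR₂ : IsLocalBlowup O R₂ R₂ :=
    ⟨hR₂O, ∅, by simp, by rw [Finset.coe_empty, Set.union_empty, Subring.closure_eq, hR₂loc]⟩
  refine ⟨R', s', N + 2, by simp [R'], by simp [s'], ?_, ?_⟩
  · intro i hi
    rcases Nat.lt_or_ge i N with hlt | hge
    · obtain ⟨hb, x, g', hx, hg', hs⟩ := hstep i hlt
      have e1 : R' i = R i := by simp [R', hlt.le]
      have e2 : R' (i + 1) = R (i + 1) := by simp [R', Nat.succ_le_of_lt hlt]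
      have e3 : s' i = s i := by simp [s', hlt.le]
      have e4 : s' (i + 1) = s (i + 1) := by simp [s', Nat.succ_le_of_lt hlt]
      rw [e1, e2, e3, e4]
      exact ⟨hb, x, g', hx, hg', hs⟩
    · rcases Nat.lt_or_ge i (N + 1) with hlt1 | hge1
      · have hi' : i = N := by omega
        subst hi'
        have e1 : R' i = R i := by simp [R']
        have e2 : R' (i + 1) = R₂ := by simp [R']
        have e3 : s' i = s i := by simp [s']
        have e4 : s' (i + 1) = s i := by simp [s']
        rw [e1, e2, e3, e4]
        exact ⟨hbl, 1, 0, one_mem _, zero_mem _, by ring⟩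
      · have hi' : i = N + 1 := by omega
        subst hi'
        have e1 : R' (N + 1) = R₂ := by simp [R']
        have e2 : R' (N + 1 + 1) = R₂ := by simp [R']
        have e3 : s' (N + 1) = s N := by simp [s']
        have e4 : s' (N + 1 + 1) = t₁ := by simp [s']
        rw [e1, e2, e3, e4]
        refine ⟨hblR₂, yt, g, hytR, hNR₂ g.2, ?_⟩
        rw [ht₁, mul_div_cancel₀ _ hyt0]; ring
  · rw [hR'N2]
    refine ⟨hreg₂, hR₂O, hcen₂, ?_⟩
    rw [hs'N2]
    refine ⟨ht₁R, ⟨z₂ ia, hz₂ ia⟩, ⟨Wv, hWvR⟩, yt, Subtype.ext (by simpa using ht₁sq), hWunit, hP, ?_⟩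
    by_cases hva : O.valuation (z₂ ia) < 1
    · left
      obtain ⟨_, hzia, hnsq⟩ := hF₂.not_mem_sq ia hva
      exact ⟨(hcen₂ _).mpr hva, hnsq⟩
    · right
      have hvia : O.valuation (z₂ ia) = 1 := le_antisymm ((O.valuation_le_one_iff _).mpr (hR₂O (hz₂ ia))) (not_lt.mp hva)
      refine ⟨?_, fun h => ?_⟩
      · by_contra hnu
        exact hva ((hcen₂ _).mp ((IsLocalRing.mem_maximalIdeal _).mpr hnu))
      -- case B: the transported end theorem
      obtain ⟨hγ, hu⟩ := hunit₂ ia ⟨z₂ ia, hz₂ ia⟩ rfl hvia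
      have hw0 : resK O (w : K) ≠ 0 := by
        rw [Ne, resK_eq_zero_iff O (hRO w.2), hvw]; exact lt_irrefl _
      -- `Φ` kills the monomials `r_i` (each has a non-unit letter), so `Φ W = w̄`
      have hΦrv : ∀ i, s₂.Φ ⟨rv i, hrvR i⟩ = 0 := by
        intro i
        -- some letter with positive exponent is a non-unit
        have hex : ∃ j, 0 < gv i j ∧ O.valuation (z₂ j) < 1 := by
          by_contra hall
          push Not at hall
          have h1 : O.valuation (rv i) = 1 := by
            show O.valuation (∏ j, z₂ j ^ gv i j) = 1
            rw [map_prod]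
            refine Finset.prod_eq_one fun j _ => ?_
            rw [map_zpow₀]
            rcases (hgnn i j).lt_or_eq with hpos | h0
            · have hvj : O.valuation (z₂ j) = 1 :=
                le_antisymm ((O.valuation_le_one_iff _).mpr (hR₂O (hz₂ j))) (hall j hpos)
              rw [hvj, one_zpow]
            · rw [← h0, zpow_zero]
          exact absurd (hrv1 i) (by rw [h1]; exact lt_irrefl _)
        obtain ⟨j, hpos, hvj⟩ := hex
        have hsplit : (⟨rv i, hrvR i⟩ : R₂) = ⟨z₂ j, hz₂ j⟩ * ⟨∏ j', z₂ j' ^ Function.update (gv i) j (gv i j - 1) j', by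
            rw [prod_zpow_eq_prod_pow_toNat z₂ _ (fun j' => by
              by_cases h : j' = j
              · subst h; rw [Function.update_self]; omega
              · rw [Function.update_of_ne h]; exact hgnn i j')]
            exact prod_mem fun j' _ => pow_mem (hz₂ j') _⟩ := by
          apply Subtype.ext
          show (∏ j', z₂ j' ^ gv i j') = z₂ j * ∏ j', z₂ j' ^ Function.update (gv i) j (gv i j - 1) j'
          rw [← prod_zpow_indicator z₂ j, ← SteerToricConcl.prod_zpow_add z₂ hz₂0]
          refine Finset.prod_congr rfl fun j' _ => ?_
          congr 1
          by_cases h : j' = j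
          · subst h; rw [if_pos rfl, Function.update_self]; omega
          · rw [if_neg h, Function.update_of_ne h]; omega
        rw [hsplit, map_mul, hkill₂ j ⟨z₂ j, hz₂ j⟩ rfl hvj, zero_mul]
      have hΦW : s₂.Φ ⟨Wv, hWvR⟩ = algebraMap (MvPolynomial (K × ℕ) (ResidueField O)) (Localization.AtPrime (kerRes O))
          (MvPolynomial.C (resK O (w : K))) := by
        have e : (⟨Wv, hWvR⟩ : R₂) = ⟨(w : K), hNR₂ w.2⟩ + ∑ i, ⟨(a i : K), hNR₂ (a i).2⟩ * ⟨rv i, hrvR i⟩ :=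
          Subtype.ext (by simp [hWv])
        rw [e, map_add, map_sum, Finset.sum_eq_zero fun i _ => by rw [map_mul, hΦrv i, mul_zero], add_zero]
        exact hconst₂ ⟨(w : K), hNR₂ w.2⟩ w.2
      exact unit_sub_sq_not_mem_sq_of_dual O R₂ hR₂O' s₂.Φ hΦ₂ (maximalIdeal R₂) (fun q hq => (hcen₂ q).mp hq)
        ⟨z₂ ia, hz₂ ia⟩ ⟨Wv, hWvR⟩ h (resK O (w : K)) hw0 hΦW (s₂.kp ia) (s₂.km ia) (s₂.γ ia) hγ hu
        (fun v hv => (hsupp₂ ia v hv).1) (s₂.c ia) (hdual₂.self hvia)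

end Tower

/-! ## K-TX, unconditional -/

section KTX

/-- **K-TX (res-L0-w41-strat-1's `concl_of_unit_dominant_monomial`, stub `stub_unit_linear_tower` retyped per RULING 258(c)).**
Unit-dominant monomial with an odd exponent at a member reached by local blowings up ⇒ `Concl O A₀ t` (displayed unfolded): the toric
tower `exists_toric_tower_caseB`, then the exit — case A (`z ∈ 𝔪 ∖ 𝔪²`) by `isRegularLocalRing_adjoinRoot_linear_unit`, case B (`z` a
unit, `z·W − h² ∉ 𝔪²` for all `h`) by `RadicandSingular.not_isRegularLocalRing_adjoinRoot_atMaximalIdeal_iff` — and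
`SteeredExit.concl_of_exit`. OURS. [cite: NovacoskiSpivakovsky2014, Def. 2.8, Lemma 2.5, Lemma 2.9] [cite: Matsumura1987, Thm. 14.2] -/
theorem concl_of_unit_dominant_monomial [CharP K 2] (O : ValuationSubring K) (A₀ : Subalgebra k K)
    (h₀ : A₀.toSubring ≤ O.toSubring) (t : K) (hfg : A₀.FG)
    (hfr : IsFractionRing (Algebra.adjoin k (insert t (A₀ : Set K))) K)
    (R : ℕ → Subring K) (hR0 : R 0 = locAtCentre A₀.toSubring O)
    (s : ℕ → K) (N : ℕ) (hs0 : s 0 = t)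
    (hstep : ∀ i < N, IsLocalBlowup O (R i) (R (i + 1)) ∧
      ∃ x g : K, x ∈ R i ∧ g ∈ R i ∧ s i = x * s (i + 1) + g)
    (hreg : IsRegularLocalRing (R N))
    (hRO : R N ≤ O.toSubring) (hcen : ∀ a : R N, a ∈ maximalIdeal (R N) ↔ O.valuation (a : K) < 1)
    {n m : ℕ} (y : Fin n → R N) (hy : Ideal.span (Set.range y) = maximalIdeal (R N))
    (hn : ringKrullDim (R N) = n)
    (g w : R N) (hw : IsUnit w) (a : Fin m → R N)
    (M : Fin n → ℕ) (hodd : ∃ j, Odd (M j)) (E : Fin m → Fin n → ℕ)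
    (heq : s N ^ 2 = (g : K) ^ 2 + (w : K) * ∏ j, (y j : K) ^ M j +
      ∑ i, (a i : K) * ∏ j, (y j : K) ^ E i j)
    (hdom : ∀ i, O.valuation (∏ j, (y j : K) ^ E i j) < O.valuation (∏ j, (y j : K) ^ M j)) :
    ∃ (A : Subalgebra k K) (h : A.toSubring ≤ O.toSubring), A₀ ≤ A ∧ t ∈ A ∧ A.FG ∧
      IsFractionRing A K ∧ IsRegularLocalRing (Localization.AtPrime
        (Ideal.comap (Subring.inclusion h) (IsLocalRing.maximalIdeal O))) := by
  obtain ⟨R', s', N', hR0', hs0', hstep', hreg', hR'O, hcen', hsq, z, W, r, hzW, hW, hPM, hcase⟩ :=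
    exists_toric_tower_caseB O R s N hstep hreg hRO hcen y hy hn g w hw a M hodd E heq hdom
  haveI := hreg'
  haveI : CharP (R' N') 2 := CharP.subring' K 2 (R' N')
  haveI : Fact (2 : ℕ).Prime := ⟨Nat.prime_two⟩
  have hregT : IsRegularLocalRing (AdjoinRoot (X ^ 2 -
      C (algebraMap (R' N') (Localization.AtPrime (maximalIdeal (R' N'))) ⟨s' N' ^ 2, hsq⟩))) := by
    rw [hzW]
    rcases hcase with hA | ⟨-, hB⟩
    · exact isRegularLocalRing_adjoinRoot_linear_unit z W hA.1 hA.2 hW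
    · by_contra hnot
      obtain ⟨c, hc⟩ := (RadicandSingular.not_isRegularLocalRing_adjoinRoot_atMaximalIdeal_iff (S := R' N') 2 (z * W)).mp hnot
      exact hB c hc
  exact SteeredExit.concl_of_exit O A₀ h₀ t hfg hfr two_pos R' (hR0'.trans hR0) s' N' (hs0'.trans hs0) hstep'
    inferInstance hsq hregT

end KTX

end Summit.ResolutionOfSingularities.ResolutionOfSingularities.Theorems.SteerToricUnitExit

end
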